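import Summits.BirchSwinnertonDyer.BirchSwinnertonDyer.Theorems.GenusKolyvaginAtTwoPowDvdShaCardAtTwoRTBottomRungParity
import Summits.BirchSwinnertonDyer.BirchSwinnertonDyer.Theorems.GenusKolyvaginAtTwoPowDvdShaCardAtTwoRTNonPhantomPowHabitat
import Summits.BirchSwinnertonDyer.BirchSwinnertonDyer.Theorems.GenusKolyvaginAtTwoPowDvdShaCardAtTwoRTGrossLevelAtTwo
import HarnessLib

/-!
# Route `GenusKolyvaginAtTwo`, crux L_T `PowDvdShaCardAtTwoRT` (stmt-BirchSwinnertonDyer-23242), LINE 18 stub KS, bottom rung: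
# THE BOTTOM RUNG ON THE CUT HABITAT — (NPh) and the level-4 Gross condition discharged BY NAME

LEAD seat `bsd-line-gk2-p1` g17 (cell `bsd-f1-sign2`), `--supports 23242 --as helper`.  ONE THEOREM; no `sorry`; standard axioms.
BSD is NOT proved by any of this; neither is the crux, nor stub KS, nor stub L.

WHY.  The director adopted (D-NPh) (2026-08-29 11:40Z) as a scope restriction: LINE 18 runs on «`W` has an odd prime of multiplicative
reduction» (the registered `stub_nonPhantomAtTwo` is false off it — LEAD memo §11, gk2-p5 g21).  On that habitat the two displayed inputs of
`exists_deep_notTwoDvd_of_gross_witness` (`…RTBottomRungParity` §4) that are now theorems are discharged here by name: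
* (NPh_L^{2N}) := gk2-p3 g22 `NonPhantomPow.nonPhantomAtTwo_of_hasMultiplicativeReductionAt` (p714902);
* `FrobEqFrobInfty W K (2^2)` at the witness primes := gk2-p5 g22 `GrossLevelAtTwo.frobEqFrobInfty_two_pow_of_frobEqFrobInfty_two` (p720492)
  from the GROSS–Kolyvagin currency «Zhang ∧ index ≥ 2 ∧ `FrobEqFrobInfty W K 2`» (Gross (3.3); a bare Zhang prime with `Frob ≡ 1` on `E[2]`
  stays outside, as it must).
What stays displayed: the (V44)-socket `hTr` (planner antecedent (D-V44), memo §10) and Q2 (`KolyvaginRelationAtTwo`, route antecedent).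
Namespace `…Theorems.GenusExact.RelaxedCount`.  Closes nothing.

References: [McCallumLMS1991] §5 Prop. 5.2 (proof, p. 285), Prop. 4.4; [GrossLMS1991] §3 (3.3), Prop. 3.7; [Kolyvagin1991MathAnn] Thm. 2.2.
-/

-- the Theorems namespace of this sub repeats the summit name by design (D-0017 nested layout)
set_option linter.dupNamespace false

noncomputable section

open scoped Classical

open Field NumberField IsDedekindDomain Function WeierstrassCurve Rat.HeightOneSpectrum
open Literature.NumberTheory.EllipticCurves
open Literature.NumberTheory.GaloisRepresentations
open Literature.NumberTheory.GaloisCohomology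
open Summit.BirchSwinnertonDyer.BirchSwinnertonDyer.Theses.GenusKolyvaginAtTwo (KolyvaginRelationAtTwo)
open Summit.BirchSwinnertonDyer.Rank1Residual (X11b.KolyvaginAssembly.discr_lt_neg_four JET.exists_compatible_data_of_grossCM)
open Summit.BirchSwinnertonDyer.BirchSwinnertonDyer.Theorems.GenusExact.VisiblePairAtTwo
  (natCast_mem_primesEquiv_symm natGenerator_eq_of_natCast_prime_mem natCast_prime_mem_iff_eq exists_natCast_mem
    torsionBy_two_eq_bot_of_surj torsionH1OfDvd_mem_torsionLocalKer)

namespace Summit.BirchSwinnertonDyer.BirchSwinnertonDyer.Theorems.GenusExact.RelaxedCount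

variable (W : WeierstrassCurve ℚ) [W.IsElliptic] [W.IsGloballyMinimal] [NeZero (W.conductorNorm ℤ)]
  {K : Type} [Field K] [NumberField K]

/-! ## §5 The bottom rung ON THE CUT HABITAT («∃ odd multiplicative prime», director (D-NPh) 11:40Z): (NPh) and the level-4 Gross
condition DISCHARGED by name (gk2-p3 `nonPhantomAtTwo_of_hasMultiplicativeReductionAt`, gk2-p5 `frobEqFrobInfty_two_pow_of_frobEqFrobInfty_two`) -/

/-- **THE BOTTOM RUNG on the cut habitat, crux currency, classical witness currency.**  On L's frame with Q2, GIVEN one odd place `v ∣ N`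
of multiplicative reduction (the (D-NPh) binder), from a square-free `n₀` of GROSS–Kolyvagin primes (Zhang ∧ `FrobEqFrobInfty W K 2`, Gross (3.3)) of index `≥ 2`
(the level-4 Gross condition follows on `Δ < 0` with the 2-adic tower onto — gk2-p5 g22) carrying a datum with `P(n₀) ∉ 2E(K[n₀])`: an all-deep square-free
`n` (index `≥ L`), `ω(n) ∈ {ω(n₀), ω(n₀)+1}`, with a datum `P(n) ∉ 2E(K[n])`.  Displayed residuals: ONLY the (V44)-socket `hTr` and Q2.
[cite: McCallumLMS1991, §5 Prop. 5.2 and its proof, p. 285] [cite: GrossLMS1991, §3 (3.3), Prop. 3.7] -/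
theorem exists_deep_notTwoDvd_of_witness_onHabitat (hQ2 : KolyvaginRelationAtTwo) (hcm : ¬ W.HasCM) (hΔ : W.Δ < 0)
    (hT : Odd W.tamagawaProduct) (hρ : ∀ m : ℕ, W.HasSurjectiveModNGaloisRep (2 ^ m : ℕ))
    (hK : IsImaginaryQuadratic K) (hodd : Odd (NumberField.discr K)) (h3 : NumberField.discr K ≠ -3)
    (hHe : SatisfiesHeegnerHypothesis (W.conductorNorm ℤ) K) (hns : ¬ IsSquare ((NumberField.discr K : ℚ) * -|W.Δ|))
    (hns₂ : ¬ IsSquare ((NumberField.discr K : ℚ) * (-(2 * |W.Δ|))))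
    {v : HeightOneSpectrum (𝓞 ℚ)} (h2v : ((2 : ℕ) : 𝓞 ℚ) ∉ v.asIdeal) (hNv : ((W.conductorNorm ℤ : ℕ) : 𝓞 ℚ) ∈ v.asIdeal)
    (hmult : W.HasMultiplicativeReductionAt v)
    (Dt : ModularForms.ModularParametrizationData W (W.conductorNorm ℤ)) (β : ℤ) (ι : K →+* ℂ) {L : ℕ} (hL2 : 2 ≤ L)
    (hTr : ∀ (n' : ℕ) (d' : KolyvaginHeegnerData Dt β ι n') (Z : galoisCohomology (W.torsionGaloisModule ((2 ^ 2 : ℕ) : ℤ)) 1),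
      Squarefree n' →
      (∀ q ∈ n'.primeFactors, Zhang2014.IsKolyvaginPrime (W.conductorNorm ℤ) W K 2 q ∧ 2 ≤ Zhang2014.kolyvaginIndex W 2 q ∧
        FrobEqFrobInfty W K (2 ^ 2) q) →
      resTorsion W K ((2 ^ 2 : ℕ) : ℤ) Z = d'.kolyvaginClass Nat.prime_two 2 →
      ∀ (v : HeightOneSpectrum (𝓞 ℚ)) (ℓ : ℕ), ℓ ∈ n'.primeFactors → (ℓ : 𝓞 ℚ) ∈ v.asIdeal →
        L ≤ Zhang2014.kolyvaginIndex W 2 ℓ → FrobEqFrobInfty W K (2 ^ L) ℓ →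
        ∀ 𝔓 ∈ v.primesAbove, ∀ F c₀ : absoluteGaloisGroup ℚ, IsArithFrobAt (𝓞 ℚ) F 𝔓 →
          IsComplexConjugation (Rat.castHom ℝ) c₀ → (∀ P : geomTorsion W ((2 ^ 2 : ℕ) : ℤ), F • P = c₀ • P) →
          ∃ P₁ : geomTorsion W ((2 ^ 2 : ℕ) : ℤ), h1Eval W _ ((2 : ℕ) • Z) F = F • P₁ - P₁)
    {n₀ : ℕ} (hn₀ : Squarefree n₀)
    (hn₀K : ∀ q ∈ n₀.primeFactors, Zhang2014.IsKolyvaginPrime (W.conductorNorm ℤ) W K 2 q ∧ 2 ≤ Zhang2014.kolyvaginIndex W 2 q ∧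
      FrobEqFrobInfty W K 2 q)
    (e₀ : KolyvaginHeegnerData Dt β ι n₀)
    (he₀ : ¬ ∃ Q : (W.baseChange (ringClassField K ι n₀)).toAffine.Point, (2 : ℤ) • Q = e₀.derivedPoint) :
    ∃ (n : ℕ) (e : KolyvaginHeegnerData Dt β ι n), Squarefree n ∧
      (n.primeFactors.card = n₀.primeFactors.card ∨ n.primeFactors.card = n₀.primeFactors.card + 1) ∧
      (∀ q ∈ n.primeFactors, Zhang2014.IsKolyvaginPrime (W.conductorNorm ℤ) W K 2 q ∧ L ≤ Zhang2014.kolyvaginIndex W 2 q) ∧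
      ¬ ∃ Q : (W.baseChange (ringClassField K ι n)).toAffine.Point, (2 : ℤ) • Q = e.derivedPoint := by
  have hρ' : ∀ n : ℕ, 0 < n → W.HasSurjectiveModNGaloisRep ((2 : ℤ) ^ n) := fun n _ ↦ by exact_mod_cast hρ n
  have hNPh := NonPhantomPow.nonPhantomAtTwo_of_hasMultiplicativeReductionAt W hT hρ' hK hodd hns hns₂
    (NeZero.ne (W.conductorNorm ℤ)) hHe h2v hNv hmult L (by omega)
  have hn₀K' : ∀ q ∈ n₀.primeFactors, Zhang2014.IsKolyvaginPrime (W.conductorNorm ℤ) W K 2 q ∧ 2 ≤ Zhang2014.kolyvaginIndex W 2 q ∧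
      FrobEqFrobInfty W K (2 ^ 2) q := fun q hq ↦
    ⟨(hn₀K q hq).1, (hn₀K q hq).2.1, GrossLevelAtTwo.frobEqFrobInfty_two_pow_of_frobEqFrobInfty_two W K hK hΔ (M := 2) (by norm_num)
      (hρ 2) (hn₀K q hq).1 (hn₀K q hq).2.1 (hn₀K q hq).2.2⟩
  exact exists_deep_notTwoDvd_of_gross_witness W hQ2 hcm hΔ hT hρ hK hodd h3 hHe hns Dt β ι hL2 hNPh hTr hn₀ hn₀K' e₀ he₀

end Summit.BirchSwinnertonDyer.BirchSwinnertonDyer.Theorems.GenusExact.RelaxedCount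

end
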